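import Summits.Ventures.Crystal3D.Theorems.StickyWulffConstantTextureBuildLayerPropagationFrame
import Summits.Ventures.Crystal3D.Theorems.StickyWulffConstantTextureBuildHalfDefect
import Summits.Ventures.Crystal3D.Theorems.StickyWulffConstantTextureBuildBarlowShells
import Summits.Ventures.Crystal3D.Theorems.StickyWulffConstantTextureBuildHealLabelled
import HarnessLib

/-!
# TB-1 brick: TINY CHARTS — a presented ball whose twelve site-neighbours are balls is the centre of a radius-`1` chart in the SAME frame (chaining descents)
# (lane T, crux `TextureLiminfV5`, stmt-Ventures-23912; memo HOME/wulff-p2/g25/SLAB-PLATES-g25.md §7–§8)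

HONEST FRAMING. Venture `Summits/Ventures/Crystal3D` (cell `crystal3d-full`), route `route-Ventures-StickyWulffConstant`, helper `--supports` the
law-v5 crux `TextureLiminfV5` (stmt-Ventures-23912).  Bookkeeping (census-free, standard axioms) over `stacking_rebase` ('…LayerPropagationFrame'), the kissing
number (`cdeg_le_twelve`, '…HalfDefect') and the twelve touching sites of a stacking (`ncard_touching_stacking_eq_twelve`).  No cover is built; F-C1 not moved.

WHY.  `descentPropagation_shell` ('…DescentInFrame') continues the reading of a grain IN THE FRAME ALREADY IN HAND from any ball `b'` that is the centre of a
«tiny chart»: `stacking L b' σ'` carrying every ball within `1` of `b'` and complete within `1` of `b'`.  A certified region supplies exactly such balls: a ball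
`b' = x c₀` on the presentation `stacking L b σ` whose twelve neighbour SITES are balls.  This file does the conversion:

* `mem_stacking_of_touching_of_complete` — kissing-number pigeonhole: if the twelve sites of `S` touching the ball `x c₀ ∈ S` are balls, every ball touching
  `x c₀` is one of them (a thirteenth kissing ball is impossible);
* **`exists_tinyChart`** — then, for some Hägg word `σ'`, `stacking L b σ = stacking L (x c₀) σ'`, and this presentation carries every ball within `1` of
  `x c₀` and is complete within `1` of `x c₀` — the hypotheses `hcarry/hcomp` (`r = 1`) of `descentPropagation_shell`, same frame `L`.
-/

noncomputable section

namespace Summit.Ventures.Crystal3D.Theorems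

open Literature.MathematicalPhysics.StatisticalMechanics
open Summit.Ventures.Crystal3D.Cruxes.TextureLiminf.TexShadow (stacking one_le_dist_of_mem_stacking)

variable {N : ℕ} {x : Fin N → EuclideanSpace ℝ (Fin 3)}

/-- **Kissing-number pigeonhole.**  `x c₀` a site of the Hägg presentation `S`; if every site of `S` at distance `1` from `x c₀` is a ball, then every ball at
distance `1` from `x c₀` is a site of `S`. -/
theorem mem_stacking_of_touching_of_complete (hx : IsUnitPacking x) {L : EuclideanSpace ℝ (Fin 3) ≃ₗᵢ[ℝ] EuclideanSpace ℝ (Fin 3)}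
    {b : EuclideanSpace ℝ (Fin 3)} {σ : ℤ → ℤ} (hσ : IsHaggSeq σ) {c₀ : Fin N} (hb : x c₀ ∈ stacking L b σ)
    (hnb : ∀ w ∈ stacking L b σ, dist (x c₀) w = 1 → w ∈ Set.range x) {c : Fin N} (hc : dist (x c₀) (x c) = 1) :
    x c ∈ stacking L b σ := by
  classical
  by_contra hnot
  set X : Finset (EuclideanSpace ℝ (Fin 3)) := Finset.univ.image x with hXdef
  set B : Finset (EuclideanSpace ℝ (Fin 3)) := X.filter fun q => dist (x c₀) q = 1 with hBdef
  have hB12 : B.card ≤ 12 := cdeg_le_twelve X (image_sep hx) (x c₀)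
  have hT := ncard_touching_stacking_eq_twelve hσ hb
  have hTfin : {y | y ∈ stacking L b σ ∧ dist (x c₀) y = 1}.Finite := Set.finite_of_ncard_pos (by rw [hT]; norm_num)
  -- the twelve touching sites and the extra ball `x c` are thirteen distinct elements of `B`
  have hsub : insert (x c) {y | y ∈ stacking L b σ ∧ dist (x c₀) y = 1} ⊆ (↑B : Set (EuclideanSpace ℝ (Fin 3))) := by
    intro y hy
    rcases Set.mem_insert_iff.1 hy with rfl | ⟨hyS, hyd⟩
    · exact Finset.mem_coe.2 (Finset.mem_filter.2 ⟨Finset.mem_image.2 ⟨c, Finset.mem_univ _, rfl⟩, hc⟩)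
    · obtain ⟨c', hc'⟩ := hnb y hyS hyd
      exact Finset.mem_coe.2 (Finset.mem_filter.2 ⟨Finset.mem_image.2 ⟨c', Finset.mem_univ _, hc'⟩, hyd⟩)
  have hnotin : x c ∉ {y | y ∈ stacking L b σ ∧ dist (x c₀) y = 1} := fun h => hnot h.1
  have h13 : (insert (x c) {y | y ∈ stacking L b σ ∧ dist (x c₀) y = 1}).ncard = 13 := by
    rw [Set.ncard_insert_of_notMem hnotin hTfin, hT]
  have hle := Set.ncard_le_ncard hsub (Finset.finite_toSet B)
  rw [h13, Set.ncard_coe_finset] at hle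
  omega

/-- **TINY CHART in the same frame.**  A ball `x c₀` on the Hägg presentation `stacking L b σ` whose twelve neighbour sites are balls is the centre of a
presentation `stacking L (x c₀) σ'` (SAME frame `L`, same site set) carrying every ball within `1` of it and complete within `1` of it. -/
theorem exists_tinyChart (hx : IsUnitPacking x) {L : EuclideanSpace ℝ (Fin 3) ≃ₗᵢ[ℝ] EuclideanSpace ℝ (Fin 3)} {b : EuclideanSpace ℝ (Fin 3)}
    {σ : ℤ → ℤ} (hσ : IsHaggSeq σ) {c₀ : Fin N} (hb : x c₀ ∈ stacking L b σ)
    (hnb : ∀ w ∈ stacking L b σ, dist (x c₀) w = 1 → w ∈ Set.range x) :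
    ∃ σ' : ℤ → ℤ, IsHaggSeq σ' ∧ stacking L b σ = stacking L (x c₀) σ' ∧
      (∀ c, dist (x c) (x c₀) ≤ 1 → x c ∈ stacking L (x c₀) σ') ∧
      (∀ w ∈ stacking L (x c₀) σ', dist w (x c₀) ≤ 1 → w ∈ Set.range x) := by
  obtain ⟨k₀, hk₀⟩ := stacking_rebase hb
  refine ⟨fun t => σ (t + k₀), isHaggSeq_shift hσ k₀, hk₀, ?_, ?_⟩
  · intro c hc
    rw [← hk₀]
    by_cases hcc : c = c₀
    · subst hcc; exact hb
    · have h1 : 1 ≤ dist (x c) (x c₀) := hx hcc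
      have heq : dist (x c₀) (x c) = 1 := by rw [dist_comm]; linarith
      exact mem_stacking_of_touching_of_complete hx hσ hb hnb heq
  · intro w hw hwd
    rw [← hk₀] at hw
    by_cases hwb : w = x c₀
    · exact ⟨c₀, hwb.symm⟩
    · have h1 : 1 ≤ dist w (x c₀) := one_le_dist_of_mem_stacking hσ hw hb hwb
      exact hnb w hw (by rw [dist_comm]; linarith)

end Summit.Ventures.Crystal3D.Theorems

end
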